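import Mathlib
import HarnessLib

/-!
# Generalized Fermat equations of signature `(5, 5, p)`: `x⁵ + y⁵ = d z^p` (Billerey–Dieulefait 2010)

Topic `Literature/NumberTheory/DiophantineGeometry` (same shelf as `GeneralizedFermatSignatureNN2.lean` [BS04] and
`GeneralizedFermatSignatureNN3.lean` [BVY04]).

Content: the three Diophantine THEOREMS of N. Billerey, L. V. Dieulefait, *Solving Fermat-type equations `x⁵ + y⁵ = dz^p`*,
Math. Comp. **79** (2010) 535–544, doi:10.1090/S0025-5718-09-02294-7 [BillereyDieulefait2010] (held: arXiv:0802.1217, whose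
section numbering is used for the locators) — Theorems 3.1, 3.2, 3.3 (§3) — each typed from the held text as a NAMED FACT
`def … : Prop` with the statement AS PRINTED; nothing is proved or discharged here (the proofs are the modular method: Frey curve
`E(a,b) : y² = x³ − 5(a²+b²)x² + 5((a⁵+b⁵)/(a+b))x` (1.1), conductor/weight by [Billerey2007], Ribet's level lowering, Prop. 1.1 and
the newform eliminations of §3 with Stein's tables).

Rendering conventions (uniform, recorded again in the docstrings). (1) [§1, p. 1]: "Let `p` be a prime number `≥ 7` and `d` be a
positive integer. We say that a solution `(a,b,c)` of the equation `x⁵+y⁵=dz^p` is primitive if `(a,b)=1` and non-trivial if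
`c ≠ 0` (note that this is not the same definition as in [Bil07])." — so "no non-trivial primitive solution" is rendered
`∀ a b c : ℤ, IsCoprime a b → c ≠ 0 → a⁵ + b⁵ ≠ d·c^p`; (2) exponents are natural numbers, `p` prime in the printed range;
(3) `d` a natural number cast to `ℤ`.

What is deliberately NOT here: Prop. 1.1 and the Frey-trace lists of §2 (typed, as named hypotheses of a reduction, in the
venture cell file `Summits/Ventures/AbcShadow/SH04/BD10Package.lean`), §4 (modular obstructions, `d = 3`), [Billerey2007]'s own
theorems. Adjacent to the abc / Fermat–Catalan circle of problems; NOT a claim on abc.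
-/

namespace Literature.NumberTheory.DiophantineGeometry

namespace BillereyDieulefait2010

/-- **Non-trivial primitive solution** [BD10, §1, p. 1]: "a solution `(a,b,c)` of the equation `x⁵+y⁵=dz^p` is primitive if
`(a,b)=1` and non-trivial if `c ≠ 0`". [cite: BillereyDieulefait2010, §1 p.1 (definitions)] -/
def IsNontrivialPrimitiveSolution (d p : ℕ) (a b c : ℤ) : Prop :=
  a ^ 5 + b ^ 5 = (d : ℤ) * c ^ p ∧ IsCoprime a b ∧ c ≠ 0

/-- **[BD10, Theorem 3.1]** (§3.1), as printed: "Assume `d = 2^α·3^β·5^γ` with `α ≥ 2` and `β, γ` arbitrary. Then, the equation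
`x⁵+y⁵=dz^p` does not have non-trivial primitive solutions for `p ≥ 13`." (`p` prime, standing assumption of §1; "generalizes
Theorems 1.2 and 1.3 of [Bil07]".) [cite: BillereyDieulefait2010, Thm 3.1] -/
def thm31 : Prop :=
  ∀ p : ℕ, p.Prime → 13 ≤ p → ∀ α β γ : ℕ, 2 ≤ α →
    ∀ a b c : ℤ, ¬ IsNontrivialPrimitiveSolution (2 ^ α * 3 ^ β * 5 ^ γ) p a b c

/-- **[BD10, Theorem 3.2]** (§3.2), as printed: "The equation `x⁵+y⁵=7z^p` does not have non-trivial primitive solutions for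
`p ≥ 13`." (Proof: levels `350, 1400, 2800`, [mfd].) [cite: BillereyDieulefait2010, Thm 3.2] -/
def thm32 : Prop :=
  ∀ p : ℕ, p.Prime → 13 ≤ p → ∀ a b c : ℤ, ¬ IsNontrivialPrimitiveSolution 7 p a b c

/-- **[BD10, Theorem 3.3]** (§3.3), as printed: "The equation `x⁵+y⁵=13z^p` does not have non-trivial primitive solutions for
`p ≥ 19`." (Proof: levels `650, 2600, 5200`, eliminations with `a′₃, a′₇, a′₁₁, a′₁₇, a′₁₉`, [mfd]/[Cr97].) The exponents
`p ∈ {7, 11, 13, 17}` are NOT covered by print. [cite: BillereyDieulefait2010, Thm 3.3] -/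
def thm33 : Prop :=
  ∀ p : ℕ, p.Prime → 19 ≤ p → ∀ a b c : ℤ, ¬ IsNontrivialPrimitiveSolution 13 p a b c

/-- Unfolding of the printed statement: `thm33` in the shape "`(a,b) = 1`, `c ≠ 0` ⇒ `a⁵ + b⁵ ≠ 13 c^p`" (bookkeeping, proved).
[cite: BillereyDieulefait2010, Thm 3.3 (unfolded form)] -/
theorem thm33_iff : thm33 ↔
    ∀ p : ℕ, p.Prime → 19 ≤ p → ∀ a b c : ℤ, IsCoprime a b → c ≠ 0 → a ^ 5 + b ^ 5 ≠ 13 * c ^ p := by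
  constructor
  · intro h p hp h19 a b c hab hc heq
    exact h p hp h19 a b c ⟨by simpa using heq, hab, hc⟩
  · rintro h p hp h19 a b c ⟨heq, hab, hc⟩
    exact h p hp h19 a b c hab hc (by simpa using heq)

end BillereyDieulefait2010

end Literature.NumberTheory.DiophantineGeometry
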